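import Mathlib
import HarnessLib

/-!
# Strassen's division elimination, homogeneous truncation and scaling interpolation (algebraic identities)

Route MonotoneRestoration, crux `OrbitRestorationQP` (stmt-ValiantsHypothesis-18293), namespace
`Summit.ValiantsHypothesis.ValiantsHypothesis.Theorems.ValueOrbitDivision`.

Pure commutative algebra behind the closure of quasi-polynomial-orbit restorability under EXACT DIVISION
(Strassen's "Vermeidung von Divisionen" in orbit currency): over a field `K`, for multivariate polynomials in any
set of variables `σ`,

* `scale_eq_sum_homogeneousComponent` — the diagonal scaling `x ↦ t·x` acts on the degree-`j` homogeneous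
  component by `t^j`: `P(t·x) = Σ_{j ≤ N} t^j · Hom_j P` for every `N ≥ deg P`;
* `homogeneousComponent_eq_sum_inv_vandermonde_scale` — INTERPOLATION: with `N + 1` distinct scalars `t_i`,
  every homogeneous component `Hom_k P` (`k ≤ N`, `N ≥ deg P`) is the `K`-linear combination
  `Σ_i (V⁻¹)_{k i} · P(t_i·x)` of scalings of `P` (`V` the Vandermonde matrix of `t`);
* `degree_ge_of_mem_support_mul_pow` / `homogeneousComponent_mul_pow_eq_zero` — if `E` has zero constant term,
  `g · E^(m+1)` has no monomial of degree `≤ m`;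
* `eq_sum_homogeneousComponent_strassen` — STRASSEN'S IDENTITY: if `F = D · h`, `D(0) = d₀ ≠ 0`, `m ≥ deg h`, then
  with `E := 1 - d₀⁻¹ D` and `P := d₀⁻¹ · F · Σ_{j ≤ m} E^j` one has `h = Σ_{k ≤ m} Hom_k P`
  (because `P = h · (1 - E^(m+1))`);
* `exists_eq_sum_scale_strassen` — hence `h = Σ_i μ_i · P(t_i·x)` for suitable scalars `μ_i`, `i ≤ N`, whenever
  `N ≥ max (m, deg P)` and the `t_i` are distinct: the quotient is a LINEAR COMBINATION OF SCALINGS of a polynomial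
  obtained from `F` and `D` by ring operations only.

Everything is proved; nothing here mentions circuits. [cite: Strassen1973, Satz 1 (division elimination)]
-/

noncomputable section

open scoped Classical
open MvPolynomial Finset

-- `Summit.ValiantsHypothesis.ValiantsHypothesis.…` is the tree's single-conjunct layout (Sub = Summit).
set_option linter.dupNamespace false

namespace Summit.ValiantsHypothesis.ValiantsHypothesis.Theorems

namespace ValueOrbitDivision

universe u v

variable {K : Type u} [Field K] {σ : Type v}

/-! ### Scaling and homogeneous components -/

/-- The diagonal scaling `x ↦ t·x` multiplies a homogeneous polynomial of degree `j` by `t^j`. [folklore] -/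
theorem scale_of_isHomogeneous (t : K) {q : MvPolynomial σ K} {j : ℕ} (hq : q.IsHomogeneous j) :
    aeval (fun x : σ => C t * X x) q = C (t ^ j) * q := by
  conv_lhs => rw [q.as_sum]
  conv_rhs => rw [q.as_sum]
  rw [map_sum, Finset.mul_sum]
  refine Finset.sum_congr rfl fun d hd => ?_
  have hdeg : d.degree = j := by
    by_contra h
    exact (mem_support_iff.mp hd) (hq.coeff_eq_zero h)
  have hprod : (d.prod fun i k => (C t * X i : MvPolynomial σ K) ^ k) =
      C (t ^ d.degree) * d.prod fun i k => (X i : MvPolynomial σ K) ^ k := by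
    simp only [Finsupp.prod]
    rw [Finsupp.degree_apply, ← Finset.prod_pow_eq_pow_sum, map_prod, ← Finset.prod_mul_distrib]
    refine Finset.prod_congr rfl fun i _ => ?_
    rw [mul_pow, map_pow]
  simp only [aeval_monomial, algebraMap_eq]
  rw [hprod, hdeg, monomial_eq]
  ring

/-- **Scaling acts diagonally on homogeneous components**: `P(t·x) = Σ_{j ≤ N} t^j · Hom_j P` for `N ≥ deg P`.
[folklore] -/
theorem scale_eq_sum_homogeneousComponent (t : K) (P : MvPolynomial σ K) {N : ℕ} (hN : P.totalDegree ≤ N) :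
    aeval (fun x : σ => C t * X x) P =
      ∑ j ∈ range (N + 1), C (t ^ j) * homogeneousComponent j P := by
  have hP : P = ∑ j ∈ range (N + 1), homogeneousComponent j P := by
    conv_lhs => rw [← sum_homogeneousComponent P]
    refine (Finset.sum_subset (fun j hj => ?_) fun j _ hj => ?_)
    · simp only [Finset.mem_range] at hj ⊢; omega
    · simp only [Finset.mem_range, not_lt] at hj
      exact homogeneousComponent_eq_zero _ _ (by omega)
  conv_lhs => rw [hP]
  rw [map_sum]
  exact Finset.sum_congr rfl fun j _ => scale_of_isHomogeneous t (homogeneousComponent_isHomogeneous j P)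

/-! ### Interpolation: homogeneous components from scalings -/

/-- **Vandermonde extraction in a module**: if `w_i = Σ_j t_i^j • v_j` with the `t_i` distinct, then
`v_k = Σ_i (V⁻¹)_{k i} • w_i`. [folklore] -/
theorem eq_sum_inv_vandermonde {M : Type*} [AddCommGroup M] [Module K M] {N : ℕ}
    (t : Fin (N + 1) → K) (ht : Function.Injective t) (v : Fin (N + 1) → M) (k : Fin (N + 1)) :
    v k = ∑ i, (Matrix.vandermonde t)⁻¹ k i • ∑ j : Fin (N + 1), t i ^ (j : ℕ) • v j := by
  have hdet : IsUnit (Matrix.vandermonde t).det :=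
    isUnit_iff_ne_zero.mpr (Matrix.det_vandermonde_ne_zero_iff.mpr ht)
  have hinv := Matrix.nonsing_inv_mul (Matrix.vandermonde t) hdet
  calc v k = ∑ j, (1 : Matrix (Fin (N + 1)) (Fin (N + 1)) K) k j • v j := by
        rw [Finset.sum_eq_single k]
        · simp
        · intro j _ hj; simp [Matrix.one_apply_ne (Ne.symm hj)]
        · intro h; exact absurd (Finset.mem_univ k) h
    _ = ∑ j, ((Matrix.vandermonde t)⁻¹ * Matrix.vandermonde t) k j • v j := by rw [hinv]
    _ = ∑ j : Fin (N + 1), ∑ i, ((Matrix.vandermonde t)⁻¹ k i * t i ^ (j : ℕ)) • v j := by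
        refine Finset.sum_congr rfl fun j _ => ?_
        rw [Matrix.mul_apply, Finset.sum_smul]
        simp only [Matrix.vandermonde_apply]
    _ = ∑ i, (Matrix.vandermonde t)⁻¹ k i • ∑ j : Fin (N + 1), t i ^ (j : ℕ) • v j := by
        rw [Finset.sum_comm]
        refine Finset.sum_congr rfl fun i _ => ?_
        rw [Finset.smul_sum]
        refine Finset.sum_congr rfl fun j _ => ?_
        rw [mul_smul]

/-- **INTERPOLATION OF HOMOGENEOUS COMPONENTS FROM SCALINGS.**  With `N ≥ deg P` and `N + 1` distinct scalars
`t_i`, `Hom_k P = Σ_i (V⁻¹)_{k i} · P(t_i·x)` for every `k ≤ N`. [folklore] -/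
theorem homogeneousComponent_eq_sum_inv_vandermonde_scale (P : MvPolynomial σ K) {N : ℕ}
    (hN : P.totalDegree ≤ N) (t : Fin (N + 1) → K) (ht : Function.Injective t) {k : ℕ} (hk : k < N + 1) :
    homogeneousComponent k P =
      ∑ i, C ((Matrix.vandermonde t)⁻¹ ⟨k, hk⟩ i) * aeval (fun x : σ => C (t i) * X x) P := by
  have key := eq_sum_inv_vandermonde (M := MvPolynomial σ K) t ht
    (fun j : Fin (N + 1) => homogeneousComponent (j : ℕ) P) ⟨k, hk⟩
  simp only at key
  rw [key]
  refine Finset.sum_congr rfl fun i _ => ?_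
  rw [smul_eq_C_mul]
  congr 1
  rw [scale_eq_sum_homogeneousComponent (t i) P hN, Finset.sum_range]
  refine Finset.sum_congr rfl fun j _ => ?_
  rw [smul_eq_C_mul]

/-! ### Low homogeneous components of `g · E^(m+1)` vanish when `E(0) = 0` -/

/-- Every monomial of `E^j` has degree `≥ j` when `E` has zero constant term. [folklore] -/
theorem degree_ge_of_mem_support_pow {E : MvPolynomial σ K} (hE : constantCoeff E = 0) :
    ∀ (j : ℕ) (d : σ →₀ ℕ), d ∈ (E ^ j).support → j ≤ d.degree := by
  intro j
  induction j with
  | zero => intro d _; exact Nat.zero_le _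
  | succ j ih =>
    intro d hd
    rw [pow_succ] at hd
    obtain ⟨d₁, hd₁, d₂, hd₂, rfl⟩ := Finset.mem_add.mp (support_mul _ _ hd)
    have h1 : j ≤ d₁.degree := ih d₁ hd₁
    have h2 : 1 ≤ d₂.degree := by
      rcases Nat.eq_zero_or_pos d₂.degree with h0 | hpos
      · exfalso
        have hd₂0 : d₂ = 0 := (Finsupp.degree_eq_zero_iff d₂).mp h0
        rw [hd₂0, mem_support_iff] at hd₂
        have hc : coeff 0 E = 0 := by
          have := congrFun (constantCoeff_eq (σ := σ) (R := K)) E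
          rw [← this]; exact hE
        exact hd₂ hc
      · exact hpos
    rw [map_add]
    omega

/-- Every monomial of `g · E^j` has degree `≥ j` when `E` has zero constant term. [folklore] -/
theorem degree_ge_of_mem_support_mul_pow (g : MvPolynomial σ K) {E : MvPolynomial σ K}
    (hE : constantCoeff E = 0) (j : ℕ) (d : σ →₀ ℕ) (hd : d ∈ (g * E ^ j).support) : j ≤ d.degree := by
  obtain ⟨d₁, _, d₂, hd₂, rfl⟩ := Finset.mem_add.mp (support_mul _ _ hd)
  have := degree_ge_of_mem_support_pow hE j d₂ hd₂
  rw [map_add]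
  omega

/-- **Low homogeneous components of `g · E^(m+1)` vanish** (`k ≤ m`, `E(0) = 0`). [folklore] -/
theorem homogeneousComponent_mul_pow_eq_zero (g : MvPolynomial σ K) {E : MvPolynomial σ K}
    (hE : constantCoeff E = 0) {m k : ℕ} (hk : k ≤ m) :
    homogeneousComponent k (g * E ^ (m + 1)) = 0 := by
  refine homogeneousComponent_eq_zero' _ _ fun d hd => ?_
  have := degree_ge_of_mem_support_mul_pow g hE (m + 1) d hd
  omega

/-! ### Strassen's identity -/

/-- **STRASSEN'S DIVISION IDENTITY.**  If `F = D · h`, the constant term `d₀` of `D` is nonzero and `m ≥ deg h`,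
then, with `E := 1 - d₀⁻¹ · D` and `P := d₀⁻¹ · F · Σ_{j < m+1} E^j`, the quotient is the degree-`≤ m` truncation
of `P`: `h = Σ_{k < m+1} Hom_k P` (indeed `P = h · (1 - E^(m+1))` and `E^(m+1)` only has monomials of degree
`> m`). [cite: Strassen1973, Satz 1] -/
theorem eq_sum_homogeneousComponent_strassen {F D h : MvPolynomial σ K} (hF : F = D * h)
    (hD : constantCoeff D ≠ 0) {m : ℕ} (hm : h.totalDegree ≤ m) :
    h = ∑ k ∈ range (m + 1), homogeneousComponent k
      (C (constantCoeff D)⁻¹ * F * ∑ j ∈ range (m + 1), (1 - C (constantCoeff D)⁻¹ * D) ^ j) := by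
  set d₀ := constantCoeff D with hd₀
  set E : MvPolynomial σ K := 1 - C d₀⁻¹ * D with hEdef
  have hE0 : constantCoeff E = 0 := by
    simp only [hEdef, map_sub, map_one, map_mul, constantCoeff_C]
    rw [← hd₀, inv_mul_cancel₀ hD, sub_self]
  -- `P = h · (1 - E^(m+1))`
  have hP : C d₀⁻¹ * F * ∑ j ∈ range (m + 1), E ^ j = h - h * E ^ (m + 1) := by
    have h1 : C d₀⁻¹ * F = (1 - E) * h := by
      rw [hF, hEdef, sub_sub_cancel, mul_assoc]
    rw [h1, mul_assoc, mul_comm h _, ← mul_assoc, mul_neg_geom_sum]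
    ring
  rw [hP]
  simp only [map_sub, Finset.sum_sub_distrib]
  have hvan : ∑ k ∈ range (m + 1), homogeneousComponent k (h * E ^ (m + 1)) = 0 :=
    Finset.sum_eq_zero fun k hk =>
      homogeneousComponent_mul_pow_eq_zero h hE0 (Nat.lt_succ_iff.mp (Finset.mem_range.mp hk))
  rw [hvan, sub_zero]
  conv_lhs => rw [← sum_homogeneousComponent h]
  refine Finset.sum_subset (fun j hj => ?_) fun j _ hj => ?_
  · simp only [Finset.mem_range] at hj ⊢; omega
  · simp only [Finset.mem_range, not_lt] at hj
    exact homogeneousComponent_eq_zero _ _ (by omega)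

/-- **THE QUOTIENT IS A LINEAR COMBINATION OF SCALINGS** of Strassen's polynomial `P` (built from `F` and `D` by ring
operations): if `F = D · h`, `D(0) ≠ 0`, `m ≥ deg h`, `N ≥ m`, `N ≥ deg P` and `t_0, …, t_N` are distinct, then
`h = Σ_i μ_i · P(t_i·x)` for some scalars `μ_i`. [cite: Strassen1973, Satz 1] -/
theorem exists_eq_sum_scale_strassen {F D h : MvPolynomial σ K} (hF : F = D * h)
    (hD : constantCoeff D ≠ 0) {m N : ℕ} (hm : h.totalDegree ≤ m) (hmN : m ≤ N)
    (hN : (C (constantCoeff D)⁻¹ * F *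
      ∑ j ∈ range (m + 1), (1 - C (constantCoeff D)⁻¹ * D) ^ j).totalDegree ≤ N)
    (t : Fin (N + 1) → K) (ht : Function.Injective t) :
    ∃ μ : Fin (N + 1) → K, h = ∑ i, C (μ i) *
      aeval (fun x : σ => C (t i) * X x)
        (C (constantCoeff D)⁻¹ * F * ∑ j ∈ range (m + 1), (1 - C (constantCoeff D)⁻¹ * D) ^ j) := by
  set P := C (constantCoeff D)⁻¹ * F * ∑ j ∈ range (m + 1), (1 - C (constantCoeff D)⁻¹ * D) ^ j with hPdef
  refine ⟨fun i => ∑ k ∈ range (m + 1),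
    if hk : k < N + 1 then (Matrix.vandermonde t)⁻¹ ⟨k, hk⟩ i else 0, ?_⟩
  have hS := eq_sum_homogeneousComponent_strassen hF hD hm
  rw [← hPdef] at hS
  have hk' : ∀ k ∈ range (m + 1), homogeneousComponent k P =
      ∑ i, C (if hk : k < N + 1 then (Matrix.vandermonde t)⁻¹ ⟨k, hk⟩ i else 0) *
        aeval (fun x : σ => C (t i) * X x) P := by
    intro k hk
    have hkN : k < N + 1 := by have := Finset.mem_range.mp hk; omega
    rw [homogeneousComponent_eq_sum_inv_vandermonde_scale P hN t ht hkN]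
    refine Finset.sum_congr rfl fun i _ => ?_
    rw [dif_pos hkN]
  rw [hS, Finset.sum_congr rfl hk', Finset.sum_comm]
  refine Finset.sum_congr rfl fun i _ => ?_
  rw [← Finset.sum_mul, ← map_sum]

end ValueOrbitDivision

end Summit.ValiantsHypothesis.ValiantsHypothesis.Theorems

end
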